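import Literature.Barriers.HodgeConjecture.GeneralizedHodgeTrivialReasonsGysinLine
import Literature.AlgebraicGeometry.HodgeTheory.ComplexGysinHodgeType
import HarnessLib

/-!
# Grothendieck (1969), p. 300: "`Filt'ᵖ ⊗ ℂ` is a sub-Hodge structure" — the Gysin line with its
# last explicit hypothesis (the bidegree of the Gysin morphisms) PROVED: the named fact from
# named facts of the tree only

Companion to `GeneralizedHodgeTrivialReasonsSubHodge` (the named fact
`Grothendieck1969_supportedClasses_isSubHodge`), `…GysinLine` and `…SubHodgeProofs` (Grothendieck's
printed proof line, p. 300: "`Filt'ᵖ` can be also described as the space generated by the images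
of the Gysin homomorphisms `H^{i-2q}(Y^an, ℚ) → Hⁱ(X^an, ℚ)` for desingularizations `Y` of closed
subschemes `T` of `X` […] As the previous homomorphisms are compatible with the Hodge structures,
the assertion follows", assembled there from the named facts `hD` (Deligne, Hodge III Cor. 8.2.8),
`hH` (Hironaka), `hM` (Hodge models), `hI` (independence of `H^{p,q}` from the model) and ONE
explicit, un-named hypothesis `hG`: the Gysin morphisms `complexGysin μ` have bidegree `(c, c)`,
Voisin I §7.3.2), and to `HodgeTheory/ComplexGysinHodgeType`, which now PROVES `hG`
(`isOfHodgeType_complexGysin`: Voisin I §7.3.2 with Lemma 7.30, on the tree's carriers) from `hI`,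
`hM` and de Rham's theorem in multiplicative form
(`Literature.NumberTheory.Transcendental.exists_deRhamIsoFamily`, named fact `hdR`, through the
tree's `cupPreservesHodgeType_of_nonempty_hodgeModel`).

Results (theorems only; no definition, no named fact — D-0026): the five reductions of
`…GysinLine` with `hG` discharged, i.e. with EVERY hypothesis a named fact of the tree —
`Grothendieck1969_supportedClasses_isSubHodge_of_deRham` (the named fact of this unit),
`…_le_hodgeConiveau_of_deRham` (Voisin 2014 Thm. 2.39 (ii)), `…_le_hodgeFiltration_of_deRham`
(Grothendieck's (∗)), `…_rationalSupportedClasses_evenRank_of_deRham` (the parity consequence),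
`Grothendieck1969_generalHodgeConjecture_false_of_deRham` (the barrier) — and the smooth case of
one closed `T` WITHOUT Deligne or Hironaka (`isSubHodge_map_ker_restrictCompl_of_isClosedImmersion_of_deRham`).
The orientation family is any one (orientations of the closed manifolds `Y(ℂ)` exist,
`Motives.ComplexPoints.isOrientableOver`; `nonempty_orientationFamily`).

Residual trust base of `Grothendieck1969_supportedClasses_isSubHodge_holds` along Grothendieck's
line, now entirely NAMED: `Deligne1974_ker_restrictCompl_eq_iSup_range_complexGysin` (XL: mixed
Hodge theory; reduced in `GysinKernelWeights` to `MixedHodgeStructureOfPair.existsDeligne` +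
Hodge III Prop. 8.2.5 + local contractibility of algebraic sets), `Resolution.Hironaka1964_projective`,
`nonempty_hodgeModel`, `hodgePQ_independent_of_hodgeModel`, `exists_deRhamIsoFamily`.

## References

* [GrothendieckTopology1969] A. Grothendieck, Topology 8 (1969) 299–303, p. 300 and footnote †.
* [VoisinHodgeI2002] C. Voisin, Hodge Theory and Complex Algebraic Geometry I, §7.3.2 with
  Lemma 7.30 (Gysin morphisms have bidegree `(r, r)`), §7.3.1 (7.5).
* [DeligneHodgeIII1974] P. Deligne, Théorie de Hodge III, Cor. 8.2.8.
* [VoisinChowRings2014] C. Voisin, Chow Rings …, Thm. 2.39.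
* [WarnerGTM94] F. W. Warner, Foundations of Differentiable Manifolds and Lie Groups, Thm. 5.36 /
  5.45 (de Rham's theorem, multiplicative).
-/

noncomputable section

open scoped Manifold
open CategoryTheory AlgebraicGeometry

namespace Literature.Barriers.HodgeConjecture

section Barriers
section HodgeConjecture

open Literature.AlgebraicGeometry.HodgeTheory Literature.AlgebraicGeometry.Motives
  Literature.AlgebraicTopology.SingularHomology
open Literature.AlgebraicGeometry.Resolution (Hironaka1964_projective)
open Literature.NumberTheory.Transcendental (exists_deRhamIsoFamily)

/-- **Orientation families exist**: every closed manifold `Y(ℂ)` of a smooth projective `Y` is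
`ℂ`-orientable (`Motives.ComplexPoints.isOrientableOver`; the intended one is the complex
orientation, but the results below hold for any). [cite: HatcherAT2002, §3.3 p. 235]
[cite: FultonYoungTableaux1997, Appendix B §B.1 (4)] -/
theorem nonempty_orientationFamily : Nonempty OrientationFamily :=
  ⟨fun _ _ hY ↦ (ComplexPoints.isOrientableOver ℂ hY).some⟩

/-! ### One smooth closed `T`: neither Deligne nor Hironaka -/

section Kernel

variable {n : ℕ} {X : SchemeOver ℂ}

/-- **The kernel of restriction off a SMOOTH closed subvariety is a sub-Hodge structure of
Hodge coniveau `≥ codim`, from Hodge models and de Rham's theorem alone.** For a closed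
immersion `i : Y ⟶ X` of smooth projective varieties, `dim X = dim Y + c`, Hodge models `B` of
`Y` and `A` of `X`, the compatibility of cup products with Hodge types on `Y` and `X`, and `hI`:
`ker (Hᵏ(X(ℂ); ℂ) → Hᵏ((X ∖ Y)(ℂ); ℂ))`, pulled back to `A`, is a sub-Hodge structure contained
in `⨆_{p, q ≥ c} H^{p,q}` — Thom–Gysin exactness (`…_of_isClosedImmersion` of `…GysinLine`) and
the bidegree `(c, c)` of `i_*` (`isOfHodgeType_complexGysin_of_cupPreservesHodgeType`).
[cite: GrothendieckTopology1969, p. 300] [cite: VoisinHodgeI2002, §7.3.2 (with Lemma 7.30)] -/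
theorem isSubHodge_map_ker_restrictCompl_of_isClosedImmersion_of_cupPreservesHodgeType
    (hI : hodgePQ_independent_of_hodgeModel) (μ : OrientationFamily) (hX : IsSmoothProjective n X)
    {m : ℕ} {Y : SchemeOver ℂ} (hY : IsSmoothProjective m Y) (i : Y ⟶ X)
    [IsClosedImmersion i.left] (B : HodgeModel m Y) (A : HodgeModel n X)
    (hcY : CupPreservesHodgeType m Y) (hcX : CupPreservesHodgeType n X) (k : ℕ) {c : ℕ}
    (hc : m + c = n) :
    A.IsSubHodge k ((LinearMap.ker
        (complexBetti.restrictCompl X (Set.range i.left.base) k).hom).map (A.pullback k).hom) ∧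
      (LinearMap.ker (complexBetti.restrictCompl X (Set.range i.left.base) k).hom).map
          (A.pullback k).hom ≤ A.hodgeConiveau k c :=
  isSubHodge_map_ker_restrictCompl_of_isClosedImmersion hI μ hX hY i B A k hc
    fun _ hab _ _ _ hy ↦
      isOfHodgeType_complexGysin_of_cupPreservesHodgeType hI μ hY hX B A hcY hcX i hab
        (by omega) (by omega) hy

/-- The same from the named facts `hodgePQ_independent_of_hodgeModel`, `nonempty_hodgeModel`
(for `Y` and `X`) and de Rham's theorem `exists_deRhamIsoFamily`.
[cite: GrothendieckTopology1969, p. 300] [cite: VoisinHodgeI2002, §7.3.2 (with Lemma 7.30)] -/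
theorem isSubHodge_map_ker_restrictCompl_of_isClosedImmersion_of_deRham
    (hI : hodgePQ_independent_of_hodgeModel)
    (hdR : ∀ (E : Type) [NormedAddCommGroup E] [NormedSpace ℂ E] [FiniteDimensional ℂ E],
      exists_deRhamIsoFamily 𝓘(ℝ, E))
    (μ : OrientationFamily) (hX : IsSmoothProjective n X) (hMX : nonempty_hodgeModel n X)
    {m : ℕ} {Y : SchemeOver ℂ} (hY : IsSmoothProjective m Y) (hMY : nonempty_hodgeModel m Y)
    (i : Y ⟶ X) [IsClosedImmersion i.left] (A : HodgeModel n X) (k : ℕ) {c : ℕ} (hc : m + c = n) :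
    A.IsSubHodge k ((LinearMap.ker
        (complexBetti.restrictCompl X (Set.range i.left.base) k).hom).map (A.pullback k).hom) ∧
      (LinearMap.ker (complexBetti.restrictCompl X (Set.range i.left.base) k).hom).map
          (A.pullback k).hom ≤ A.hodgeConiveau k c :=
  isSubHodge_map_ker_restrictCompl_of_isClosedImmersion_of_cupPreservesHodgeType hI μ hX hY i
    (hMY.nonempty hY).some A (cupPreservesHodgeType_of_nonempty_hodgeModel hI hMY hdR hY)
    (cupPreservesHodgeType_of_nonempty_hodgeModel hI hMX hdR hX) k hc

end Kernel

/-! ### The named fact and its companions from named facts only -/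

section Reductions

/-- **`Grothendieck1969_supportedClasses_isSubHodge` from named facts of the tree only**
(Grothendieck's own line, p. 300, with footnote †): Deligne's description of `Filt'` by Gysin
images of desingularizations (`hD`, `hH`), Hodge models (`hM`), THE Hodge decomposition (`hI`),
and "the previous homomorphisms are compatible with the Hodge structures" — now the theorem
`isOfHodgeType_complexGysin` (Voisin I §7.3.2 with Lemma 7.30) from `hI`, `hM` and de Rham's
theorem `hdR`. [cite: GrothendieckTopology1969, p. 300 and footnote †]
[cite: DeligneHodgeIII1974, Cor. 8.2.8] [cite: VoisinHodgeI2002, §7.3.2 (with Lemma 7.30)] -/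
theorem Grothendieck1969_supportedClasses_isSubHodge_of_deRham
    (hD : Deligne1974_ker_restrictCompl_eq_iSup_range_complexGysin)
    (hH : Hironaka1964_projective.{0})
    (hM : ∀ (m : ℕ) (Y : SchemeOver ℂ), nonempty_hodgeModel m Y)
    (hI : hodgePQ_independent_of_hodgeModel)
    (hdR : ∀ (E : Type) [NormedAddCommGroup E] [NormedSpace ℂ E] [FiniteDimensional ℂ E],
      exists_deRhamIsoFamily 𝓘(ℝ, E)) :
    Grothendieck1969_supportedClasses_isSubHodge :=
  Grothendieck1969_supportedClasses_isSubHodge_of_gysin hD hH hM hI nonempty_orientationFamily.some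
    (isOfHodgeType_complexGysin hI hM hdR _)

/-- **`HodgeTheory.Grothendieck1969_supportedClasses_le_hodgeConiveau` (Voisin 2014, Thm. 2.39
(ii): `Nˢ Hᵏ` has Hodge coniveau `≥ s`) from named facts only.**
[cite: GrothendieckTopology1969, pp. 299–300] [cite: VoisinChowRings2014, Thm. 2.39]
[cite: VoisinHodgeI2002, §7.3.2 (with Lemma 7.30)] -/
theorem Grothendieck1969_supportedClasses_le_hodgeConiveau_of_deRham
    (hD : Deligne1974_ker_restrictCompl_eq_iSup_range_complexGysin)
    (hH : Hironaka1964_projective.{0})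
    (hM : ∀ (m : ℕ) (Y : SchemeOver ℂ), nonempty_hodgeModel m Y)
    (hI : hodgePQ_independent_of_hodgeModel)
    (hdR : ∀ (E : Type) [NormedAddCommGroup E] [NormedSpace ℂ E] [FiniteDimensional ℂ E],
      exists_deRhamIsoFamily 𝓘(ℝ, E)) :
    Grothendieck1969_supportedClasses_le_hodgeConiveau :=
  Grothendieck1969_supportedClasses_le_hodgeConiveau_of_gysin hD hH hM hI
    nonempty_orientationFamily.some (isOfHodgeType_complexGysin hI hM hdR _)

/-- **Grothendieck's inclusion (∗), `Filt'ᵖ ⊂ Filtᵖ`, from named facts only.**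
[cite: GrothendieckTopology1969, p. 299 (∗)] [cite: VoisinHodgeI2002, §7.3.2 (with Lemma 7.30)] -/
theorem Grothendieck1969_supportedClasses_le_hodgeFiltration_of_deRham
    (hD : Deligne1974_ker_restrictCompl_eq_iSup_range_complexGysin)
    (hH : Hironaka1964_projective.{0})
    (hM : ∀ (m : ℕ) (Y : SchemeOver ℂ), nonempty_hodgeModel m Y)
    (hI : hodgePQ_independent_of_hodgeModel)
    (hdR : ∀ (E : Type) [NormedAddCommGroup E] [NormedSpace ℂ E] [FiniteDimensional ℂ E],
      exists_deRhamIsoFamily 𝓘(ℝ, E)) :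
    Grothendieck1969_supportedClasses_le_hodgeFiltration :=
  (Grothendieck1969_supportedClasses_le_hodgeConiveau_of_deRham hD hH hM hI
    hdR).supportedClasses_le_hodgeFiltration

/-- **The even rank of `Filt'ᵖ Hⁱ(X, ℚ)`, `i` odd, from named facts only** (parity step proved in
`…Parity`, in a real Hodge model `hR`). [cite: GrothendieckTopology1969, p. 300]
[cite: VoisinHodgeI2002, Cor. 6.13 and §7.3.2] -/
theorem Grothendieck1969_rationalSupportedClasses_evenRank_of_deRham
    (hD : Deligne1974_ker_restrictCompl_eq_iSup_range_complexGysin)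
    (hH : Hironaka1964_projective.{0})
    (hM : ∀ (m : ℕ) (Y : SchemeOver ℂ), nonempty_hodgeModel m Y)
    (hI : hodgePQ_independent_of_hodgeModel)
    (hdR : ∀ (E : Type) [NormedAddCommGroup E] [NormedSpace ℂ E] [FiniteDimensional ℂ E],
      exists_deRhamIsoFamily 𝓘(ℝ, E))
    (hR : exists_isReal_hodgeModel) :
    Grothendieck1969_rationalSupportedClasses_evenRank :=
  Grothendieck1969_rationalSupportedClasses_evenRank_of_isSubHodge_of_exists_isReal
    (Grothendieck1969_supportedClasses_isSubHodge_of_deRham hD hH hM hI hdR) hR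

/-- **The barrier `Grothendieck1969_generalHodgeConjecture_false` from named facts only** (both
Hodge-theoretic inputs of pp. 299–300 along the Gysin line; the Hodge structure of `H³(E_τ³)` in
the Künneth basis is the named fact `hE`). [cite: GrothendieckTopology1969, pp. 299–300]
[cite: DeligneHodgeIII1974, Cor. 8.2.8] [cite: VoisinHodgeI2002, §7.3.2 (with Lemma 7.30)] -/
theorem Grothendieck1969_generalHodgeConjecture_false_of_deRham
    (hD : Deligne1974_ker_restrictCompl_eq_iSup_range_complexGysin)
    (hH : Hironaka1964_projective.{0})
    (hM : ∀ (m : ℕ) (Y : SchemeOver ℂ), nonempty_hodgeModel m Y)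
    (hI : hodgePQ_independent_of_hodgeModel)
    (hdR : ∀ (E : Type) [NormedAddCommGroup E] [NormedSpace ℂ E] [FiniteDimensional ℂ E],
      exists_deRhamIsoFamily 𝓘(ℝ, E))
    (hE : Grothendieck1969_ellipticCurveCubed_hodgeDecomposition) :
    Grothendieck1969_generalHodgeConjecture_false :=
  Grothendieck1969_generalHodgeConjecture_false_of_hodgeDecomposition_of_hodgeConiveau hE
    (Grothendieck1969_supportedClasses_isSubHodge_of_deRham hD hH hM hI hdR)
    (Grothendieck1969_supportedClasses_le_hodgeConiveau_of_deRham hD hH hM hI hdR)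

end Reductions

end HodgeConjecture
end Barriers

end Literature.Barriers.HodgeConjecture

end
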